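import Mathlib
import HarnessLib
import Summits.HubbardSuperconductivity.HubbardSuperconductivity.Theorems.KLProgrammeKLRegimeSplitThermalLayerV5
import Summits.HubbardSuperconductivity.HubbardSuperconductivity.Theorems.KLProgrammeMatsubaraZeroSoundAnnulus
import Summits.HubbardSuperconductivity.HubbardSuperconductivity.Theorems.KLProgrammeMatsubaraZeroSoundWeighted

/-!
# Route `KLProgramme` — crux K3 split, ENGINE child (`KLRegimeEngineV7` stmt-HubbardSuperconductivity-19662 and its gen-3 successor on
# `klPredsV8`): the (T) discharge chain on the EXTENDED ladder `n ≤ n_β + 1`, and the same-slice zero-transfer bubble IN SCALE FORM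
# (cell gate-hubbard-kl, seat hubbard-kl-k3c2-p2 «thermal-bar induction n ≤ nScales β + 1»)

WHY.  The engine step stubs (`stub_engine_step` of the V7 skeleton 5fb5f617, `stub_engine_step_values` of the V8 shape) range over
`1 ≤ n ≤ nScales β + 1`: the last index is the fully integrated slice `Λ_{n_β+1} < π/β` (`klScale_nScales_succ_lt`).  Every scale-form
lemma of the (T) chain landed so far (`klti_matsubara_error_le_ratio / _le_inv_pow / _le_thermalBar`, `…SplitThermalLayerV5` p455683;
`klth_ratio_le_inv_pow`, `klth_card_matsubara_below_scale_le`, `…SplitThermalLayer` p454158) carries the hypothesis `n ≤ nScales β` —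
it uses `2π/β ≤ 2Λ_n`, false at `n = n_β + 1`.  This module closes the gap with the constants a step prover can quote at EVERY
`n ≤ n_β + 1`:
* §1 the dictionary on the extended ladder: `π/β ≤ 4Λ_n`, `2π/β ≤ 8Λ_n`, `(π/β)/Λ_n ≤ 4` and `(π/β)/Λ_n ≤ 4·4^{-(n_β − n)}`
  (ℕ-subtraction; at `n = n_β + 1` the right side is `4`); at the slot: `C·(Klam U)²·(π/β)/Λ_n ≤ thermalBar G P U β n` once `4C ≤ G.CF`,
  and the profile form `c·(Klam U)²·4^{-(n_β − n)} ≤ thermalBar` for `c ≤ G.CF`;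
* §2 the Matsubara (midpoint-Riemann) error in scale form for `n ≤ n_β + 1`: support `|k₀| ≤ aΛ_n`, Lipschitz constant `D ≤ A/Λ_n²` ⇒
  `‖β⁻¹•Σ_i g(ω_i) − (2π)⁻¹•∫g‖ ≤ ((a+8)A/π)·(π/β)/Λ_n ≤ (4(a+8)A/π)·4^{-(n_β − n)} ≤ thermalBar` (size condition `4(a+8)A/π ≤ C(Klam U)²`,
  `C ≤ G.CF`);
* §3 at most `7·4^{n_β − n}` kept Matsubara frequencies below `Λ_n`, now for all `n ≤ n_β + 1`;
* §4 THE SAME-SLICE ZERO-TRANSFER PARTICLE–HOLE BUBBLE IN SCALE FORM (one call for the step prover): the shell weight `F(t²)` (product of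
  the two slice weights; `‖F‖ ≤ M_F`, `L_F`-Lipschitz in `s = t²` with `L_F ≤ ℓ/Λ_n²`, supported in `Λ_n²/4 < s < (4Λ_n)²` — k3c2-p3's
  `klld_slice_support`) against `((−ik₀ + e)²)⁻¹` and an `e`-insertion `W` (Jacobian of the frame coordinates × slow vertex factor,
  continuous, `‖W(e) − W(0)‖ ≤ L_W|e|`, `‖W‖ ≤ B_W` on `|e| < 4Λ_n`), for `β ≥ klBetaMin`, `n ≤ n_β + 1`, `M ≥ β·4Λ_n/(2π) + 1`:
  `‖β⁻¹•Σ_i ∫ F(ω_i² + e²)·((−iω_i + e)²)⁻¹·W(e) de‖ ≤ (524288/π)·(ℓ + 8M_F)·L_W·Λ_n + (393216/π)·(ℓ + 8M_F)·B_W·(π/β)/Λ_n`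
  (`klte_slice_bubble_weighted_norm_le`): the first term is the zero-sound remainder `∝ Λ_n = e₀4^{-n}` of the «below-resolution» branch
  of `phGainOf` (the flat part cancels exactly — p1's `klzs_*`; only the insertion's slope survives), the second is the thermal term,
  `≤ (1572864/π)·(ℓ + 8M_F)·B_W·4^{-(n_β − n)}` (`klte_slice_bubble_weighted_le_profile`).  With `F` flat (`W ≡ 1`):
  `klte_slice_bubble_norm_le`.
Pure real/complex analysis on the tree's `klScale`, `nScales`, `thermalBar`, `matsubaraFreq`; nothing about the model is asserted.
References: BGM 2006 = Benfatto–Giuliani–Mastropietro, Ann. Henri Poincaré 7 (2006) 809, §2.3 (2.31a), (2.38), Lemma 2.2a; DECOMP App. E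
Lemma E.2 (ii)–(iv); HOME/hubbard-kl-k3c2-p2/THERMAL-NOTE.md §2; `…ShellGainProfiles` (`phGainOf`, p1 g6).
-/

noncomputable section

namespace Summit.HubbardSuperconductivity.HubbardSuperconductivity.Theorems.KLRegimeSplit

set_option linter.dupNamespace false -- summit = problem name (single-conjunct summit), D-0017

open Real Finset MeasureTheory Complex Literature.MathematicalPhysics.QuantumLattice Literature.Probability.LatticeModels
open Summit.HubbardSuperconductivity.HubbardSuperconductivity.Theorems.KLProgrammeLegKernels

/-! ## §1 The dictionary on the extended ladder `n ≤ n_β + 1` -/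

/-- `Λ_{n_β} ≤ 4Λ_n` for `n ≤ n_β + 1` (`Λ_{n_β+1} = Λ_{n_β}/4 ≤ Λ_n`). -/
theorem klte_klScale_nScales_le_four_mul {β : ℝ} {n : ℕ} (hn : n ≤ nScales β + 1) :
    klScale klE0 (nScales β) ≤ 4 * klScale klE0 n := by
  have h1 : klScale klE0 (nScales β + 1) ≤ klScale klE0 n := by
    unfold klScale
    have he : (0 : ℝ) < klE0 := by norm_num [klE0]
    exact mul_le_mul_of_nonneg_left (inv_anti₀ (by positivity) (pow_le_pow_right₀ (by norm_num) hn)) he.le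
  rw [klth_klScale_succ] at h1
  linarith

/-- **The temperature is below four times every scale of the extended ladder**: `π/β ≤ 4Λ_n` for `n ≤ n_β + 1`, `β ≥ klBetaMin`. -/
theorem klte_pi_div_le_four_mul_klScale {β : ℝ} (hβ : klBetaMin ≤ β) {n : ℕ} (hn : n ≤ nScales β + 1) :
    Real.pi / β ≤ 4 * klScale klE0 n :=
  (klth_pi_div_le_klScale_nScales hβ).trans (klte_klScale_nScales_le_four_mul hn)

/-- The Matsubara mesh on the extended ladder: `2π/β ≤ 8Λ_n` for `n ≤ n_β + 1`, `β ≥ klBetaMin`. -/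
theorem klte_two_pi_div_le_eight_mul_klScale {β : ℝ} (hβ : klBetaMin ≤ β) {n : ℕ} (hn : n ≤ nScales β + 1) :
    2 * Real.pi / β ≤ 8 * klScale klE0 n := by
  have := klte_pi_div_le_four_mul_klScale hβ hn
  rw [mul_div_assoc]
  linarith

/-- The temperature-to-scale ratio is at most `4` on the extended ladder. -/
theorem klte_ratio_le_four {β : ℝ} (hβ : klBetaMin ≤ β) {n : ℕ} (hn : n ≤ nScales β + 1) :
    (Real.pi / β) / klScale klE0 n ≤ 4 := by
  rw [div_le_iff₀ (klth_klScale_pos n)]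
  exact klte_pi_div_le_four_mul_klScale hβ hn

/-- **The dictionary on the extended ladder**: `(π/β)/Λ_n ≤ 4·4^{-(n_β − n)}` for every `n ≤ n_β + 1` (`β ≥ klBetaMin`; ℕ-subtraction,
so at `n = n_β + 1` the bound reads `≤ 4`). -/
theorem klte_ratio_le_four_mul_inv_pow {β : ℝ} (hβ : klBetaMin ≤ β) {n : ℕ} (hn : n ≤ nScales β + 1) :
    (Real.pi / β) / klScale klE0 n ≤ 4 * ((4 : ℝ) ^ (nScales β - n))⁻¹ := by
  rcases Nat.lt_or_ge n (nScales β + 1) with hlt | hge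
  · have h := klth_ratio_le_inv_pow hβ (Nat.lt_succ_iff.mp hlt)
    have h0 : 0 ≤ ((4 : ℝ) ^ (nScales β - n))⁻¹ := by positivity
    linarith
  · obtain rfl : n = nScales β + 1 := le_antisymm hn hge
    rw [Nat.sub_eq_zero_of_le (Nat.le_succ _), pow_zero, inv_one, mul_one]
    exact klte_ratio_le_four hβ le_rfl

/-- **The dictionary at the slot, extended ladder**: a Matsubara-discretisation error of the form `C·(Klam U)²·(π/β)/Λ_n` with `0 ≤ C`,
`4C ≤ G.CF` is `≤ thermalBar G P U β n` for every `n ≤ n_β + 1` (`β ≥ klBetaMin`). -/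
theorem klte_ratio_mul_le_thermalBar {G : GeoConsts} {C : ℝ} (hC : 0 ≤ C) (hCF : 4 * C ≤ G.CF) (P : SplitConsts) (U : ℝ) {β : ℝ}
    (hβ : klBetaMin ≤ β) {n : ℕ} (hn : n ≤ nScales β + 1) :
    C * (P.Klam * U) ^ 2 * ((Real.pi / β) / klScale klE0 n) ≤ thermalBar G P U β n := by
  unfold thermalBar
  have h1 := klte_ratio_le_four_mul_inv_pow hβ hn
  calc C * (P.Klam * U) ^ 2 * ((Real.pi / β) / klScale klE0 n)
      ≤ C * (P.Klam * U) ^ 2 * (4 * ((4 : ℝ) ^ (nScales β - n))⁻¹) := mul_le_mul_of_nonneg_left h1 (by positivity)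
    _ = (4 * C) * (P.Klam * U) ^ 2 * ((4 : ℝ) ^ (nScales β - n))⁻¹ := by ring
    _ ≤ G.CF * (P.Klam * U) ^ 2 * ((4 : ℝ) ^ (nScales β - n))⁻¹ :=
        mul_le_mul_of_nonneg_right (mul_le_mul_of_nonneg_right hCF (sq_nonneg _)) (by positivity)

/-- The profile form at the slot (every `n`): `c·(Klam U)²·4^{-(n_β − n)} ≤ thermalBar G P U β n` for `c ≤ G.CF`. -/
theorem klte_mul_inv_pow_le_thermalBar {G : GeoConsts} {c : ℝ} (hc : c ≤ G.CF) (P : SplitConsts) (U β : ℝ) (n : ℕ) :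
    c * (P.Klam * U) ^ 2 * ((4 : ℝ) ^ (nScales β - n))⁻¹ ≤ thermalBar G P U β n := by
  unfold thermalBar
  exact mul_le_mul_of_nonneg_right (mul_le_mul_of_nonneg_right hc (sq_nonneg _)) (by positivity)

/-! ## §2 The Matsubara error in scale form on the extended ladder -/

section ScaleForm

variable {E : Type*} [NormedAddCommGroup E] [NormedSpace ℝ E] [CompleteSpace E]

/-- **The Matsubara error in the «temperature / scale» form, extended ladder.**  `g : ℝ → E` supported in `|k₀| ≤ a·Λ_n` (`a ≥ 0`) and
`D`-Lipschitz with `D ≤ A/Λ_n²`; `β ≥ klBetaMin`, `n ≤ n_β + 1`, `M ≥ β·aΛ_n/(2π) + 1`.  Then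
`‖β⁻¹ • Σ_{i : MatsubaraIdx M} g(ω_i) − (2π)⁻¹ • ∫ g‖ ≤ ((a+8)·A/π)·((π/β)/Λ_n)`. -/
theorem klte_matsubara_error_le_ratio {g : ℝ → E} {D A a : ℝ} (hD : 0 ≤ D) (ha : 0 ≤ a)
    (hlip : ∀ t t', ‖g t - g t'‖ ≤ D * |t - t'|) {n : ℕ} (hsupp : ∀ t, a * klScale klE0 n ≤ |t| → g t = 0)
    (hDA : D ≤ A / klScale klE0 n ^ 2) {β : ℝ} (hβ : klBetaMin ≤ β) (hn : n ≤ nScales β + 1) {M : ℕ}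
    (hM : β * (a * klScale klE0 n) / (2 * Real.pi) + 1 ≤ M) :
    ‖β⁻¹ • (∑ i : MatsubaraIdx M, g (matsubaraFreq β M i)) - (2 * Real.pi)⁻¹ • ∫ t, g t‖ ≤
      ((a + 8) * A / Real.pi) * ((Real.pi / β) / klScale klE0 n) := by
  have hβ0 : 0 < β := pos_of_klBetaMin_le hβ
  have hΛ : 0 < klScale klE0 n := klth_klScale_pos n
  have hR : 0 ≤ a * klScale klE0 n := mul_nonneg ha hΛ.le
  have h1 := klmr_matsubara_sum_sub_integral_norm_le hD hlip hR hsupp hβ0 hM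
  refine h1.trans ?_
  -- `R + 2π/β ≤ (a + 8) Λ_n`
  have h2 : a * klScale klE0 n + 2 * Real.pi / β ≤ (a + 8) * klScale klE0 n := by
    have := klte_two_pi_div_le_eight_mul_klScale hβ hn
    linarith
  have hA : 0 ≤ A := by
    have : 0 ≤ A / klScale klE0 n ^ 2 := hD.trans hDA
    rwa [le_div_iff₀ (by positivity), zero_mul] at this
  calc D * (a * klScale klE0 n + 2 * Real.pi / β) / β
      ≤ (A / klScale klE0 n ^ 2) * ((a + 8) * klScale klE0 n) / β :=
        div_le_div_of_nonneg_right (mul_le_mul hDA h2 (by positivity) (hD.trans hDA)) hβ0.le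
    _ = ((a + 8) * A / Real.pi) * ((Real.pi / β) / klScale klE0 n) := by
        field_simp

/-- **The Matsubara error under the thermal profile, extended ladder**: same hypotheses; the error is `≤ (4(a+8)·A/π)·4^{-(n_β − n)}`. -/
theorem klte_matsubara_error_le_inv_pow {g : ℝ → E} {D A a : ℝ} (hD : 0 ≤ D) (ha : 0 ≤ a)
    (hlip : ∀ t t', ‖g t - g t'‖ ≤ D * |t - t'|) {n : ℕ} (hsupp : ∀ t, a * klScale klE0 n ≤ |t| → g t = 0)
    (hDA : D ≤ A / klScale klE0 n ^ 2) {β : ℝ} (hβ : klBetaMin ≤ β) (hn : n ≤ nScales β + 1) {M : ℕ}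
    (hM : β * (a * klScale klE0 n) / (2 * Real.pi) + 1 ≤ M) :
    ‖β⁻¹ • (∑ i : MatsubaraIdx M, g (matsubaraFreq β M i)) - (2 * Real.pi)⁻¹ • ∫ t, g t‖ ≤
      (4 * (a + 8) * A / Real.pi) * ((4 : ℝ) ^ (nScales β - n))⁻¹ := by
  refine (klte_matsubara_error_le_ratio hD ha hlip hsupp hDA hβ hn hM).trans ?_
  have hA : 0 ≤ A := by
    have : 0 ≤ A / klScale klE0 n ^ 2 := hD.trans hDA
    rwa [le_div_iff₀ (pow_pos (klth_klScale_pos n) 2), zero_mul] at this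
  have h := klte_ratio_le_four_mul_inv_pow hβ hn
  calc ((a + 8) * A / Real.pi) * ((Real.pi / β) / klScale klE0 n)
      ≤ ((a + 8) * A / Real.pi) * (4 * ((4 : ℝ) ^ (nScales β - n))⁻¹) := mul_le_mul_of_nonneg_left h (by positivity)
    _ = (4 * (a + 8) * A / Real.pi) * ((4 : ℝ) ^ (nScales β - n))⁻¹ := by ring

/-- **The Matsubara error lands under the slot's (T) majorant at every scale of the extended ladder**: same hypotheses, and the size is
a second-order unit below a quarter of the freezing constant, `4(a+8)·A/π ≤ C·(Klam U)²` with `0 ≤ C ≤ G.CF`.  Then the error is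
`≤ thermalBar G P U β n` (`n ≤ n_β + 1`). -/
theorem klte_matsubara_error_le_thermalBar {g : ℝ → E} {D A a : ℝ} (hD : 0 ≤ D) (ha : 0 ≤ a)
    (hlip : ∀ t t', ‖g t - g t'‖ ≤ D * |t - t'|) {n : ℕ} (hsupp : ∀ t, a * klScale klE0 n ≤ |t| → g t = 0)
    (hDA : D ≤ A / klScale klE0 n ^ 2) {β : ℝ} (hβ : klBetaMin ≤ β) (hn : n ≤ nScales β + 1) {M : ℕ}
    (hM : β * (a * klScale klE0 n) / (2 * Real.pi) + 1 ≤ M) {G : GeoConsts} (P : SplitConsts) (U : ℝ) {C : ℝ} (hC : 0 ≤ C)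
    (hCF : C ≤ G.CF) (hsize : 4 * (a + 8) * A / Real.pi ≤ C * (P.Klam * U) ^ 2) :
    ‖β⁻¹ • (∑ i : MatsubaraIdx M, g (matsubaraFreq β M i)) - (2 * Real.pi)⁻¹ • ∫ t, g t‖ ≤ thermalBar G P U β n := by
  refine (klte_matsubara_error_le_inv_pow hD ha hlip hsupp hDA hβ hn hM).trans ?_
  refine le_trans ?_ (klte_mul_inv_pow_le_thermalBar hCF P U β n)
  have _ := hC
  exact mul_le_mul_of_nonneg_right hsize (by positivity)

end ScaleForm

/-! ## §3 Matsubara frequencies below a scale of the extended ladder -/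

/-- **At most `7·4^{n_β − n}` kept Matsubara frequencies lie below scale `Λ_n`**, now for every `n ≤ n_β + 1` (`β ≥ klBetaMin`, any `M`):
below the fully integrated scale `Λ_{n_β+1} < π/β` there are at most `3 < 7 = 7·4⁰` of them by the tree's count `Λ_nβ/π + 3`. -/
theorem klte_card_matsubara_below_scale_le {β : ℝ} (hβ : klBetaMin ≤ β) {M : ℕ} {n : ℕ} (hn : n ≤ nScales β + 1)
    (S : Finset (MatsubaraIdx M)) (hS : ∀ i ∈ S, |matsubaraFreq β M i| ≤ klScale klE0 n) :
    (S.card : ℝ) ≤ 7 * (4 : ℝ) ^ (nScales β - n) := by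
  rcases Nat.lt_or_ge n (nScales β + 1) with hlt | hge
  · exact klth_card_matsubara_below_scale_le hβ (Nat.lt_succ_iff.mp hlt) S hS
  · obtain rfl : n = nScales β + 1 := le_antisymm hn hge
    have hβ0 : 0 < β := pos_of_klBetaMin_le hβ
    have h1 := card_filter_matsubaraFreq_le hβ0 (klth_klScale_pos _).le S hS
    have h2 : klScale klE0 (nScales β + 1) * β / Real.pi < 1 := by
      have h := klScale_nScales_succ_lt hβ0
      rw [div_lt_one Real.pi_pos]
      exact (lt_div_iff₀ hβ0).mp h
    rw [Nat.sub_eq_zero_of_le (Nat.le_succ _), pow_zero, mul_one]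
    linarith

/-! ## §4 The same-slice zero-transfer particle–hole bubble in scale form -/

section SliceBubble

variable {F : ℝ → ℂ} {LF MF ℓ : ℝ} {W : ℝ → ℂ} {LW BW : ℝ}

/-- **The weighted discrete bubble in the carrier's variables** (annulus form of `klzw_discrete_weighted_bubble_norm_le`): for a shell weight
`F : ℝ → ℂ` (`L_F`-Lipschitz in `s = t²`, `‖F‖ ≤ M_F`, `F(s) = 0` for `s ≤ r₁²` and for `s ≥ r₂²`, `0 < r₁`, `0 < r₂`), an insertion `W`
(continuous, `‖W(e) − W(0)‖ ≤ L_W|e|` and `‖W(e)‖ ≤ B_W` for `|e| < r₂`, `0 ≤ L_W, B_W`), `β > 0`, `M ≥ βr₂/(2π) + 1`: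
`‖β⁻¹ • Σ_i ∫ F(ω_i² + e²)·((−iω_i + e)²)⁻¹·W(e) de‖ ≤ (2π)⁻¹·4·L_G·L_W·r₂⁷ + 8·L_G·B_W·r₂⁴·(r₂ + 2π/β)/β`, `L_G = L_F/r₁⁴ + 2M_F/r₁⁶`. -/
theorem klte_annulus_weighted_bubble_norm_le {r₁ r₂ : ℝ} (hlip : ∀ s s', ‖F s - F s'‖ ≤ LF * |s - s'|) (hbd : ∀ s, ‖F s‖ ≤ MF)
    (hin : ∀ s, s ≤ r₁ ^ 2 → F s = 0) (hout : ∀ s, r₂ ^ 2 ≤ s → F s = 0) (hr₁ : 0 < r₁) (hr₂ : 0 < r₂)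
    (hW : Continuous W) (hLW : 0 ≤ LW) (hBW : 0 ≤ BW)
    (hWlip : ∀ e : ℝ, |e| < r₂ → ‖W e - W 0‖ ≤ LW * |e|) (hWbd : ∀ e : ℝ, |e| < r₂ → ‖W e‖ ≤ BW)
    {β : ℝ} (hβ : 0 < β) {M : ℕ} (hM : β * r₂ / (2 * Real.pi) + 1 ≤ M) :
    ‖β⁻¹ • ∑ i : MatsubaraIdx M,
        ∫ e : ℝ, F (matsubaraFreq β M i ^ 2 + e ^ 2) * ((-I * (matsubaraFreq β M i) + e) ^ 2)⁻¹ * W e‖ ≤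
      (2 * Real.pi)⁻¹ * (4 * (LF / r₁ ^ 4 + 2 * MF / r₁ ^ 6) * LW * r₂ ^ 7) +
        8 * (LF / r₁ ^ 4 + 2 * MF / r₁ ^ 6) * BW * r₂ ^ 4 * (r₂ + 2 * Real.pi / β) / β := by
  -- pass to the singularity-free form `G(s)(ik₀+e)²`, `G = F/s²`
  set G : ℝ → ℂ := fun s => F s / ((s : ℝ) : ℂ) ^ 2 with hG
  have hGlip : ∀ s s', ‖G s - G s'‖ ≤ (LF / r₁ ^ 4 + 2 * MF / r₁ ^ 6) * |s - s'| := fun s s' =>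
    klza_div_sq_lipschitz hlip hbd hin hr₁ s s'
  have hGsupp : ∀ s, r₂ ^ 2 ≤ s → G s = 0 := fun s hs => by simp only [hG, hout s hs, zero_div]
  have hconv : ∀ (k₀ e : ℝ), F (k₀ ^ 2 + e ^ 2) * ((-I * k₀ + e) ^ 2)⁻¹ = G (k₀ ^ 2 + e ^ 2) * (I * k₀ + e) ^ 2 := by
    intro k₀ e
    rw [klzd_integrand_eq G k₀ e]
    congr 1
    simp only [hG]
    by_cases hz : ((k₀ ^ 2 + e ^ 2 : ℝ) : ℂ) = 0
    · have hz' : k₀ ^ 2 + e ^ 2 = 0 := by exact_mod_cast hz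
      have hk : k₀ = 0 := by nlinarith [sq_nonneg k₀, sq_nonneg e]
      have he : e = 0 := by nlinarith [sq_nonneg k₀, sq_nonneg e]
      subst hk; subst he
      have : F 0 = 0 := hin 0 (by positivity)
      simp [this]
    · field_simp
  simp_rw [hconv]
  exact klzw_discrete_weighted_bubble_norm_le hGlip hGsupp hr₂ hW hLW hBW hWlip hWbd hβ hM

/-- Arithmetic of the scale form: with `r₁ = Λ/2`, `r₂ = 4Λ`, `L_F ≤ ℓ/Λ²` (`Λ > 0`) the Lipschitz constant of `G = F/s²` is
`L_F/r₁⁴ + 2M_F/r₁⁶ ≤ 16(ℓ + 8M_F)/Λ⁶`. -/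
theorem klte_LG_le {Λ : ℝ} (hΛ : 0 < Λ) (hLF : LF ≤ ℓ / Λ ^ 2) :
    LF / (Λ / 2) ^ 4 + 2 * MF / (Λ / 2) ^ 6 ≤ 16 * (ℓ + 8 * MF) / Λ ^ 6 := by
  have h6 : 0 < Λ ^ 6 := by positivity
  have h1 : LF / (Λ / 2) ^ 4 ≤ 16 * ℓ / Λ ^ 6 := by
    rw [show (Λ / 2) ^ 4 = Λ ^ 4 / 16 by ring, div_div_eq_mul_div]
    rw [div_le_div_iff₀ (by positivity) h6]
    have := mul_le_mul_of_nonneg_right hLF (show (0:ℝ) ≤ 16 * Λ ^ 6 by positivity)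
    calc LF * 16 * Λ ^ 6 = LF * (16 * Λ ^ 6) := by ring
      _ ≤ ℓ / Λ ^ 2 * (16 * Λ ^ 6) := this
      _ = 16 * ℓ * Λ ^ 4 := by field_simp
  have h2 : 2 * MF / (Λ / 2) ^ 6 = 128 * MF / Λ ^ 6 := by
    rw [show (Λ / 2) ^ 6 = Λ ^ 6 / 64 by ring]; field_simp; ring
  rw [h2]
  have : 16 * ℓ / Λ ^ 6 + 128 * MF / Λ ^ 6 = 16 * (ℓ + 8 * MF) / Λ ^ 6 := by ring
  linarith

/-- **The same-slice zero-transfer particle–hole bubble with an insertion, in scale form.**  At scale `n ≤ n_β + 1` (`β ≥ klBetaMin`): a shell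
weight `F : ℝ → ℂ` with `‖F‖ ≤ M_F` (`0 ≤ M_F`), `L_F`-Lipschitz in `s = t²` with `L_F ≤ ℓ/Λ_n²`, `F(s) = 0` for `s ≤ (Λ_n/2)²` and for
`s ≥ (4Λ_n)²`; an insertion `W : ℝ → ℂ` continuous with `‖W(e) − W(0)‖ ≤ L_W|e|`, `‖W(e)‖ ≤ B_W` for `|e| < 4Λ_n` (`0 ≤ L_W, B_W`); every
Matsubara cutoff `M ≥ β·4Λ_n/(2π) + 1`.  Then
`‖β⁻¹ • Σ_i ∫ F(ω_i² + e²)·((−iω_i + e)²)⁻¹·W(e) de‖ ≤ (524288/π)·(ℓ + 8M_F)·L_W·Λ_n + (393216/π)·(ℓ + 8M_F)·B_W·(π/β)/Λ_n` —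
zero-sound remainder (insertion slope × scale) plus thermal term (temperature / scale). -/
theorem klte_slice_bubble_weighted_norm_le (hMF : 0 ≤ MF) (hlip : ∀ s s', ‖F s - F s'‖ ≤ LF * |s - s'|) (hbd : ∀ s, ‖F s‖ ≤ MF)
    {n : ℕ} (hLF : LF ≤ ℓ / klScale klE0 n ^ 2)
    (hin : ∀ s, s ≤ (klScale klE0 n / 2) ^ 2 → F s = 0) (hout : ∀ s, (4 * klScale klE0 n) ^ 2 ≤ s → F s = 0)
    (hW : Continuous W) (hLW : 0 ≤ LW) (hBW : 0 ≤ BW)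
    (hWlip : ∀ e : ℝ, |e| < 4 * klScale klE0 n → ‖W e - W 0‖ ≤ LW * |e|)
    (hWbd : ∀ e : ℝ, |e| < 4 * klScale klE0 n → ‖W e‖ ≤ BW)
    {β : ℝ} (hβ : klBetaMin ≤ β) (hn : n ≤ nScales β + 1) {M : ℕ}
    (hM : β * (4 * klScale klE0 n) / (2 * Real.pi) + 1 ≤ M) :
    ‖β⁻¹ • ∑ i : MatsubaraIdx M,
        ∫ e : ℝ, F (matsubaraFreq β M i ^ 2 + e ^ 2) * ((-I * (matsubaraFreq β M i) + e) ^ 2)⁻¹ * W e‖ ≤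
      524288 / Real.pi * (ℓ + 8 * MF) * LW * klScale klE0 n +
        393216 / Real.pi * (ℓ + 8 * MF) * BW * ((Real.pi / β) / klScale klE0 n) := by
  set Λ := klScale klE0 n with hΛdef
  have hΛ : 0 < Λ := klth_klScale_pos n
  have hβ0 : 0 < β := pos_of_klBetaMin_le hβ
  have h0 := klte_annulus_weighted_bubble_norm_le hlip hbd hin hout (by positivity : 0 < Λ / 2) (by positivity : 0 < 4 * Λ)
    hW hLW hBW hWlip hWbd hβ0 hM
  refine h0.trans ?_
  -- the Lipschitz constant of `G`
  have hLG := klte_LG_le (ℓ := ℓ) (MF := MF) hΛ hLF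
  have hℓ : 0 ≤ ℓ := by
    have hLF0 : 0 ≤ LF := by
      have := hlip 0 1; have h0' : (0:ℝ) ≤ ‖F 0 - F 1‖ := norm_nonneg _; norm_num at this; linarith
    have : 0 ≤ ℓ / Λ ^ 2 := hLF0.trans hLF
    rwa [le_div_iff₀ (by positivity), zero_mul] at this
  have hLG0 : 0 ≤ LF / (Λ / 2) ^ 4 + 2 * MF / (Λ / 2) ^ 6 := by
    have hLF0 : 0 ≤ LF := by
      have := hlip 0 1; have h0' : (0:ℝ) ≤ ‖F 0 - F 1‖ := norm_nonneg _; norm_num at this; linarith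
    positivity
  have hK : 0 ≤ ℓ + 8 * MF := by positivity
  -- the mesh: `4Λ + 2π/β ≤ 12Λ`
  have hmesh : 4 * Λ + 2 * Real.pi / β ≤ 12 * Λ := by
    have := klte_two_pi_div_le_eight_mul_klScale hβ hn
    rw [← hΛdef] at this
    linarith
  -- first term
  have h1 : (2 * Real.pi)⁻¹ * (4 * (LF / (Λ / 2) ^ 4 + 2 * MF / (Λ / 2) ^ 6) * LW * (4 * Λ) ^ 7) ≤
      524288 / Real.pi * (ℓ + 8 * MF) * LW * Λ := by
    have hstep : 4 * (LF / (Λ / 2) ^ 4 + 2 * MF / (Λ / 2) ^ 6) * LW * (4 * Λ) ^ 7 ≤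
        4 * (16 * (ℓ + 8 * MF) / Λ ^ 6) * LW * (4 * Λ) ^ 7 := by
      have h47 : 0 ≤ (4 * Λ) ^ 7 := by positivity
      exact mul_le_mul_of_nonneg_right (mul_le_mul_of_nonneg_right (mul_le_mul_of_nonneg_left hLG (by norm_num)) hLW) h47
    have heq : 4 * (16 * (ℓ + 8 * MF) / Λ ^ 6) * LW * (4 * Λ) ^ 7 = 1048576 * (ℓ + 8 * MF) * LW * Λ := by
      field_simp; ring
    rw [heq] at hstep
    have hπ : 0 < 2 * Real.pi := by positivity
    calc (2 * Real.pi)⁻¹ * (4 * (LF / (Λ / 2) ^ 4 + 2 * MF / (Λ / 2) ^ 6) * LW * (4 * Λ) ^ 7)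
        ≤ (2 * Real.pi)⁻¹ * (1048576 * (ℓ + 8 * MF) * LW * Λ) := mul_le_mul_of_nonneg_left hstep (by positivity)
      _ = 524288 / Real.pi * (ℓ + 8 * MF) * LW * Λ := by field_simp; ring
  -- second term
  have h2 : 8 * (LF / (Λ / 2) ^ 4 + 2 * MF / (Λ / 2) ^ 6) * BW * (4 * Λ) ^ 4 * (4 * Λ + 2 * Real.pi / β) / β ≤
      393216 / Real.pi * (ℓ + 8 * MF) * BW * ((Real.pi / β) / Λ) := by
    have hstep : 8 * (LF / (Λ / 2) ^ 4 + 2 * MF / (Λ / 2) ^ 6) * BW * (4 * Λ) ^ 4 * (4 * Λ + 2 * Real.pi / β) ≤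
        8 * (16 * (ℓ + 8 * MF) / Λ ^ 6) * BW * (4 * Λ) ^ 4 * (12 * Λ) := by
      have h44 : 0 ≤ (4 * Λ) ^ 4 := by positivity
      have hm0 : 0 ≤ 4 * Λ + 2 * Real.pi / β := by positivity
      exact mul_le_mul (mul_le_mul_of_nonneg_right (mul_le_mul_of_nonneg_right
        (mul_le_mul_of_nonneg_left hLG (by norm_num)) hBW) h44) hmesh hm0 (by positivity)
    have heq : 8 * (16 * (ℓ + 8 * MF) / Λ ^ 6) * BW * (4 * Λ) ^ 4 * (12 * Λ) = 393216 * (ℓ + 8 * MF) * BW / Λ := by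
      field_simp; ring
    rw [heq] at hstep
    calc 8 * (LF / (Λ / 2) ^ 4 + 2 * MF / (Λ / 2) ^ 6) * BW * (4 * Λ) ^ 4 * (4 * Λ + 2 * Real.pi / β) / β
        ≤ (393216 * (ℓ + 8 * MF) * BW / Λ) / β := div_le_div_of_nonneg_right hstep hβ0.le
      _ = 393216 / Real.pi * (ℓ + 8 * MF) * BW * ((Real.pi / β) / Λ) := by field_simp
  exact add_le_add h1 h2

/-- **Profile form of the thermal term**: under the same hypotheses the bubble is
`≤ (524288/π)·(ℓ + 8M_F)·L_W·Λ_n + (1572864/π)·(ℓ + 8M_F)·B_W·4^{-(n_β − n)}` (`(π/β)/Λ_n ≤ 4·4^{-(n_β−n)}` on the extended ladder). -/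
theorem klte_slice_bubble_weighted_le_profile (hMF : 0 ≤ MF) (hlip : ∀ s s', ‖F s - F s'‖ ≤ LF * |s - s'|) (hbd : ∀ s, ‖F s‖ ≤ MF)
    {n : ℕ} (hLF : LF ≤ ℓ / klScale klE0 n ^ 2)
    (hin : ∀ s, s ≤ (klScale klE0 n / 2) ^ 2 → F s = 0) (hout : ∀ s, (4 * klScale klE0 n) ^ 2 ≤ s → F s = 0)
    (hW : Continuous W) (hLW : 0 ≤ LW) (hBW : 0 ≤ BW)
    (hWlip : ∀ e : ℝ, |e| < 4 * klScale klE0 n → ‖W e - W 0‖ ≤ LW * |e|)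
    (hWbd : ∀ e : ℝ, |e| < 4 * klScale klE0 n → ‖W e‖ ≤ BW)
    {β : ℝ} (hβ : klBetaMin ≤ β) (hn : n ≤ nScales β + 1) {M : ℕ}
    (hM : β * (4 * klScale klE0 n) / (2 * Real.pi) + 1 ≤ M) :
    ‖β⁻¹ • ∑ i : MatsubaraIdx M,
        ∫ e : ℝ, F (matsubaraFreq β M i ^ 2 + e ^ 2) * ((-I * (matsubaraFreq β M i) + e) ^ 2)⁻¹ * W e‖ ≤
      524288 / Real.pi * (ℓ + 8 * MF) * LW * klScale klE0 n +
        1572864 / Real.pi * (ℓ + 8 * MF) * BW * ((4 : ℝ) ^ (nScales β - n))⁻¹ := by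
  refine (klte_slice_bubble_weighted_norm_le hMF hlip hbd hLF hin hout hW hLW hBW hWlip hWbd hβ hn hM).trans ?_
  have hℓ : 0 ≤ ℓ := by
    have hLF0 : 0 ≤ LF := by
      have := hlip 0 1; have h0' : (0:ℝ) ≤ ‖F 0 - F 1‖ := norm_nonneg _; norm_num at this; linarith
    have : 0 ≤ ℓ / klScale klE0 n ^ 2 := hLF0.trans hLF
    rwa [le_div_iff₀ (pow_pos (klth_klScale_pos n) 2), zero_mul] at this
  have h := klte_ratio_le_four_mul_inv_pow hβ hn
  have hK : 0 ≤ 393216 / Real.pi * (ℓ + 8 * MF) * BW := by positivity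
  have := mul_le_mul_of_nonneg_left h hK
  refine add_le_add le_rfl ?_
  calc 393216 / Real.pi * (ℓ + 8 * MF) * BW * ((Real.pi / β) / klScale klE0 n)
      ≤ 393216 / Real.pi * (ℓ + 8 * MF) * BW * (4 * ((4 : ℝ) ^ (nScales β - n))⁻¹) := this
    _ = 1572864 / Real.pi * (ℓ + 8 * MF) * BW * ((4 : ℝ) ^ (nScales β - n))⁻¹ := by ring

/-- **The flat case** (`W ≡ 1`: no insertion, the continuum bubble vanishes exactly): at scale `n ≤ n_β + 1`,
`‖β⁻¹ • Σ_i ∫ F(ω_i² + e²)·((−iω_i + e)²)⁻¹ de‖ ≤ (393216/π)·(ℓ + 8M_F)·(π/β)/Λ_n` — a pure thermal term. -/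
theorem klte_slice_bubble_norm_le (hMF : 0 ≤ MF) (hlip : ∀ s s', ‖F s - F s'‖ ≤ LF * |s - s'|) (hbd : ∀ s, ‖F s‖ ≤ MF)
    {n : ℕ} (hLF : LF ≤ ℓ / klScale klE0 n ^ 2)
    (hin : ∀ s, s ≤ (klScale klE0 n / 2) ^ 2 → F s = 0) (hout : ∀ s, (4 * klScale klE0 n) ^ 2 ≤ s → F s = 0)
    {β : ℝ} (hβ : klBetaMin ≤ β) (hn : n ≤ nScales β + 1) {M : ℕ}
    (hM : β * (4 * klScale klE0 n) / (2 * Real.pi) + 1 ≤ M) :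
    ‖β⁻¹ • ∑ i : MatsubaraIdx M,
        ∫ e : ℝ, F (matsubaraFreq β M i ^ 2 + e ^ 2) * ((-I * (matsubaraFreq β M i) + e) ^ 2)⁻¹‖ ≤
      393216 / Real.pi * (ℓ + 8 * MF) * ((Real.pi / β) / klScale klE0 n) := by
  have h := klte_slice_bubble_weighted_norm_le (W := fun _ => (1 : ℂ)) (LW := 0) (BW := 1) hMF hlip hbd hLF hin hout
    continuous_const le_rfl zero_le_one (fun e _ => by simp) (fun e _ => by simp) hβ hn hM
  simp only [mul_one, mul_zero, zero_mul, zero_add] at h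
  simpa using h

end SliceBubble

end Summit.HubbardSuperconductivity.HubbardSuperconductivity.Theorems.KLRegimeSplit

end
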